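import Mathlib
import Literature.Probability.LatticeModels.ThermodynamicLimit
import Literature.Probability.LatticeModels.SharpnessProofs
import Summits.CriticalPhenomena.Ising3DConformalLimit.Theorems.PrecisionLaplacianDirectCorrelationStableTailKernelScalingAux
import HarnessLib

/-!
# Helpers (V) for stub `stub_kernelScaling` of line `diffusive-branch-is-nonsaturation`
(crux `PrecisionLaplacian.DirectCorrelationStableTail`, item stmt-CriticalPhenomena-4799)

**The min trick** (registered helper sub-goal `stub_kernelScaling_auxMinTrick`): for `1 < α < 2`,
`b > 0`, `C ≥ 0`, `ε > 0` there is `γ > 0` with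
`∫ |v|₂^{α-3} min(γ, C e^{-b|v+s|₂²}) dv ≤ ε` for every shift `s ∈ ℝ³`.  Near the origin one uses the
local integrability `∫_{‖v‖≤r} ‖v‖^{α-3} = 3|B₁|r^α/α` of the kernel, far from it the splitting
`min(γ, Ce^{-bq}) ≤ (γe^{bΛ/2} + Ce^{-bΛ/2})e^{-bq/2}` at a large level `Λ` and the translation
invariance of the Gaussian integral.  Also two small arithmetic helpers.  All folklore; no definitions.
-/

noncomputable section

namespace Summit.CriticalPhenomena.Ising3DConformalLimit.Cruxes.DirectCorrelationStableTail.DiffusiveBranchIsNonsaturation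

open MeasureTheory Filter Topology
open scoped BigOperators
open Literature.Probability.LatticeModels
open Summit.CriticalPhenomena.Ising3DConformalLimit.Cruxes.DirectCorrelationStableTail.SelfEnergyPickInversion

/-! ### Small arithmetic helpers -/

/-- A positive `δ ≤ 1/4` with `M · 2δ ≤ ε/4`. [folklore] -/
theorem kernSc_exists_delta {M ε : ℝ} (hM : 0 ≤ M) (hε : 0 < ε) :
    ∃ δ : ℝ, 0 < δ ∧ δ ≤ 1 / 4 ∧ M * (2 * δ) ≤ ε / 4 := by
  refine ⟨min (1 / 4) (ε / (8 * (M + 1))), lt_min (by norm_num) (by positivity), min_le_left _ _, ?_⟩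
  have h1 : min (1 / 4) (ε / (8 * (M + 1))) ≤ ε / (8 * (M + 1)) := min_le_right _ _
  have h2 : M * (2 * (ε / (8 * (M + 1)))) ≤ ε / 4 := by
    rw [show M * (2 * (ε / (8 * (M + 1)))) = ε / 4 * (M / (M + 1)) by field_simp; ring]
    exact mul_le_of_le_one_right (by positivity) ((div_le_one (by positivity)).2 (by linarith))
  nlinarith [h1, h2]

/-- `R^{3-α} · (R³)⁻¹ = R^{-α} ≤ 1/R` for `R ≥ 1` and `α ≥ 1`. [folklore] -/
theorem kernSc_rpow_three_sub_mul_inv_cube {R α : ℝ} (hR : 1 ≤ R) (hα : 1 ≤ α) :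
    R ^ (3 - α) * (R ^ 3)⁻¹ ≤ 1 / R := by
  have hRpos : 0 < R := one_pos.trans_le hR
  have h1 : R ^ (3 - α) * (R ^ 3)⁻¹ = R ^ (-α) := by
    rw [Real.rpow_sub hRpos, Real.rpow_neg hRpos.le,
      show (R : ℝ) ^ (3 : ℝ) = R ^ (3 : ℕ) by exact_mod_cast Real.rpow_natCast R 3]
    field_simp
  rw [h1, one_div, ← Real.rpow_neg_one]
  exact Real.rpow_le_rpow_of_exponent_le hR (by linarith)

/-- `e^{-1/τ} ≤ τ` for `τ > 0`. [folklore] -/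
theorem kernSc_exp_neg_inv_le {τ : ℝ} (hτ : 0 < τ) : Real.exp (-(1 / τ)) ≤ τ := by
  have h1 : 1 / τ + 1 ≤ Real.exp (1 / τ) := Real.add_one_le_exp _
  have h2 : Real.exp (-(1 / τ)) * Real.exp (1 / τ) = 1 := by rw [← Real.exp_add]; simp
  have h3 : 0 < Real.exp (-(1 / τ)) := Real.exp_pos _
  have h4 : 1 / τ * τ = 1 := by field_simp
  nlinarith [mul_le_mul_of_nonneg_left h1 h3.le]

/-! ### The min trick -/

/-- Splitting a Gaussian at level `Λ`: `min(γ, C e^{-bq}) ≤ (γ e^{bΛ/2} + C e^{-bΛ/2}) e^{-bq/2}`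
for `b, γ, C ≥ 0`. [folklore] -/
theorem kernSc_min_le_gauss {γ C b Λ : ℝ} (q : ℝ) (hγ : 0 ≤ γ) (hC : 0 ≤ C) (hb : 0 ≤ b) :
    min γ (C * Real.exp (-(b * q))) ≤
      (γ * Real.exp (b / 2 * Λ) + C * Real.exp (-(b / 2 * Λ))) * Real.exp (-(b / 2 * q)) := by
  have hA : 0 ≤ γ * Real.exp (b / 2 * Λ) * Real.exp (-(b / 2 * q)) := by positivity
  have hB : 0 ≤ C * Real.exp (-(b / 2 * Λ)) * Real.exp (-(b / 2 * q)) := by positivity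
  by_cases h : q ≤ Λ
  · have h1 : (1 : ℝ) ≤ Real.exp (b / 2 * Λ) * Real.exp (-(b / 2 * q)) := by
      rw [← Real.exp_add]
      exact Real.one_le_exp (by nlinarith)
    calc min γ (C * Real.exp (-(b * q))) ≤ γ := min_le_left _ _
      _ ≤ γ * (Real.exp (b / 2 * Λ) * Real.exp (-(b / 2 * q))) := le_mul_of_one_le_right hγ h1
      _ ≤ _ := by nlinarith
  · push Not at h
    have h1 : Real.exp (-(b * q)) ≤ Real.exp (-(b / 2 * Λ)) * Real.exp (-(b / 2 * q)) := by
      rw [← Real.exp_add]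
      exact Real.exp_le_exp.2 (by nlinarith)
    calc min γ (C * Real.exp (-(b * q))) ≤ C * Real.exp (-(b * q)) := min_le_right _ _
      _ ≤ C * (Real.exp (-(b / 2 * Λ)) * Real.exp (-(b / 2 * q))) := mul_le_mul_of_nonneg_left h1 hC
      _ ≤ _ := by nlinarith

/-- Pointwise domination for the min trick: with `r > 0`,
`|v|₂^{α-3} min(γ, C e^{-b|v+s|₂²}) ≤ C 𝟙{‖v‖ ≤ r}‖v‖^{α-3} + r^{α-3}(γe^{bΛ/2} + Ce^{-bΛ/2}) e^{-(b/2)|v+s|₂²}`.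
[folklore] -/
theorem kernSc_minTrick_pt {α b C γ Λ r : ℝ} (hα3 : α - 3 < 0) (hb : 0 ≤ b) (hC : 0 ≤ C)
    (hγ : 0 ≤ γ) (hr : 0 < r) (s v : Fin 3 → ℝ) :
    √(∑ i, v i ^ 2) ^ (α - 3) * min γ (C * Real.exp (-(b * ∑ i, (v i + s i) ^ 2))) ≤
      C * (Metric.closedBall (0 : Fin 3 → ℝ) r).indicator (fun v => ‖v‖ ^ (α - 3)) v +
        r ^ (α - 3) * (γ * Real.exp (b / 2 * Λ) + C * Real.exp (-(b / 2 * Λ))) *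
          Real.exp (-(b / 2 * ∑ i, (v i + s i) ^ 2)) := by
  have hq : 0 ≤ ∑ i, (v i + s i) ^ 2 := Finset.sum_nonneg fun i _ => sq_nonneg _
  have hmin0 : 0 ≤ min γ (C * Real.exp (-(b * ∑ i, (v i + s i) ^ 2))) := le_min hγ (by positivity)
  have hind0 : 0 ≤ (Metric.closedBall (0 : Fin 3 → ℝ) r).indicator (fun v => ‖v‖ ^ (α - 3)) v :=
    Set.indicator_nonneg (fun w _ => Real.rpow_nonneg (norm_nonneg w) _) v
  have hfar0 : 0 ≤ r ^ (α - 3) * (γ * Real.exp (b / 2 * Λ) + C * Real.exp (-(b / 2 * Λ))) *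
      Real.exp (-(b / 2 * ∑ i, (v i + s i) ^ 2)) := by positivity
  have hsplit := kernSc_min_le_gauss (Λ := Λ) (∑ i, (v i + s i) ^ 2) hγ hC hb
  by_cases hv : ‖v‖ ≤ r
  · -- near the origin
    have hmem : v ∈ Metric.closedBall (0 : Fin 3 → ℝ) r := mem_closedBall_zero_iff.2 hv
    have h1 : √(∑ i, v i ^ 2) ^ (α - 3) ≤ ‖v‖ ^ (α - 3) := kernSc_euclid_rpow_le_norm_rpow hα3 v
    have h2 : min γ (C * Real.exp (-(b * ∑ i, (v i + s i) ^ 2))) ≤ C := by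
      refine (min_le_right _ _).trans ?_
      have h3 : Real.exp (-(b * ∑ i, (v i + s i) ^ 2)) ≤ 1 :=
        Real.exp_le_one_iff.2 (by nlinarith)
      exact (mul_le_mul_of_nonneg_left h3 hC).trans (by rw [mul_one])
    calc √(∑ i, v i ^ 2) ^ (α - 3) * min γ (C * Real.exp (-(b * ∑ i, (v i + s i) ^ 2)))
        ≤ ‖v‖ ^ (α - 3) * C := mul_le_mul h1 h2 hmin0 (Real.rpow_nonneg (norm_nonneg _) _)
      _ = C * (Metric.closedBall (0 : Fin 3 → ℝ) r).indicator (fun v => ‖v‖ ^ (α - 3)) v := by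
          rw [Set.indicator_of_mem hmem, mul_comm]
      _ ≤ _ := le_add_of_nonneg_right hfar0
  · -- far from the origin
    push Not at hv
    have h1 : √(∑ i, v i ^ 2) ^ (α - 3) ≤ r ^ (α - 3) :=
      Real.rpow_le_rpow_of_nonpos hr (hv.le.trans (norm_le_sqrt_sum_sq v)) hα3.le
    calc √(∑ i, v i ^ 2) ^ (α - 3) * min γ (C * Real.exp (-(b * ∑ i, (v i + s i) ^ 2)))
        ≤ r ^ (α - 3) * ((γ * Real.exp (b / 2 * Λ) + C * Real.exp (-(b / 2 * Λ))) *
            Real.exp (-(b / 2 * ∑ i, (v i + s i) ^ 2))) :=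
          mul_le_mul h1 hsplit hmin0 (Real.rpow_nonneg hr.le _)
      _ = r ^ (α - 3) * (γ * Real.exp (b / 2 * Λ) + C * Real.exp (-(b / 2 * Λ))) *
            Real.exp (-(b / 2 * ∑ i, (v i + s i) ^ 2)) := by ring
      _ ≤ _ := le_add_of_nonneg_left (mul_nonneg hC hind0)

/-- **The min trick.**  For `1 < α < 2`, `b > 0`, `C ≥ 0`, `ε > 0` there is `γ > 0` such that
`∫ |v|₂^{α-3} min(γ, C e^{-b|v+s|₂²}) dv ≤ ε` for every shift `s` (and the integrand is integrable).
[folklore] -/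
theorem kernSc_minTrick {α : ℝ} (hα1 : 1 < α) (hα2 : α < 2) {b C ε : ℝ} (hb : 0 < b) (hC : 0 ≤ C)
    (hε : 0 < ε) :
    ∃ γ : ℝ, 0 < γ ∧ ∀ s : Fin 3 → ℝ,
      Integrable (fun v : Fin 3 → ℝ => √(∑ i, v i ^ 2) ^ (α - 3) *
          min γ (C * Real.exp (-(b * ∑ i, (v i + s i) ^ 2)))) ∧
      ∫ v : Fin 3 → ℝ, √(∑ i, v i ^ 2) ^ (α - 3) *
          min γ (C * Real.exp (-(b * ∑ i, (v i + s i) ^ 2))) ≤ ε := by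
  have hα3 : α - 3 < 0 := by linarith
  set B : ℝ := (volume : Measure (Fin 3 → ℝ)).real (Metric.ball 0 1) with hB
  have hB0 : 0 ≤ B := measureReal_nonneg
  set J : ℝ := ∫ v : Fin 3 → ℝ, Real.exp (-(b / 2 * ∑ i, v i ^ 2)) with hJ
  have hJ0 : 0 ≤ J := integral_nonneg fun v => (Real.exp_pos _).le
  -- the radius `r = 2δ`
  set M : ℝ := C * (3 * B / α) with hM
  have hM0 : 0 ≤ M := by positivity
  obtain ⟨δ, hδ0, hδ4, hδM⟩ := kernSc_exists_delta hM0 hε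
  set r : ℝ := 2 * δ with hr
  have hr0 : 0 < r := by positivity
  have hr1 : r ≤ 1 := by linarith
  -- the level `Λ`
  set τ : ℝ := ε / 4 / (r ^ (α - 3) * C * J + 1) with hτ
  have hτ0 : 0 < τ := by positivity
  set Λ : ℝ := 2 / b * (1 / τ) with hΛ
  have hΛτ : Real.exp (-(b / 2 * Λ)) ≤ τ := by
    rw [hΛ, show b / 2 * (2 / b * (1 / τ)) = 1 / τ by field_simp]
    exact kernSc_exp_neg_inv_le hτ0
  -- the height `γ`
  set γ : ℝ := ε / 4 / (r ^ (α - 3) * Real.exp (b / 2 * Λ) * J + 1) with hγ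
  have hγ0 : 0 < γ := by positivity
  refine ⟨γ, hγ0, fun s => ?_⟩
  clear_value τ γ
  -- the dominating function
  set e₂ : (Fin 3 → ℝ) → ℝ := fun v => Real.exp (-(b / 2 * ∑ i, (v i + s i) ^ 2)) with he₂
  set D : (Fin 3 → ℝ) → ℝ := fun v =>
    C * (Metric.closedBall (0 : Fin 3 → ℝ) r).indicator (fun v => ‖v‖ ^ (α - 3)) v +
      r ^ (α - 3) * (γ * Real.exp (b / 2 * Λ) + C * Real.exp (-(b / 2 * Λ))) * e₂ v with hD
  have hball := kernSc_integral_norm_rpow_ball (β := α - 3) (by linarith) hr0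
  have hgauss : Integrable e₂ := kernSc_integrable_gauss (half_pos hb) s
  have hIe₂ : ∫ v, e₂ v = J := by
    have h := integral_add_right_eq_self (μ := (volume : Measure (Fin 3 → ℝ)))
      (fun v : Fin 3 → ℝ => Real.exp (-(b / 2 * ∑ i, v i ^ 2))) s
    simpa only [Pi.add_apply] using h
  have hi1 : Integrable (fun v => C * (Metric.closedBall (0 : Fin 3 → ℝ) r).indicator
      (fun v => ‖v‖ ^ (α - 3)) v) := hball.1.const_mul C
  have hi2 : Integrable (fun v => r ^ (α - 3) * (γ * Real.exp (b / 2 * Λ) +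
      C * Real.exp (-(b / 2 * Λ))) * e₂ v) := hgauss.const_mul _
  have hDint : Integrable D := hi1.add hi2
  have hDval : ∫ v, D v = C * (3 * B * (r ^ α / α)) +
      r ^ (α - 3) * (γ * Real.exp (b / 2 * Λ) + C * Real.exp (-(b / 2 * Λ))) * J := by
    rw [hD, integral_add hi1 hi2, integral_const_mul, integral_const_mul, hball.2, hIe₂,
      show α - 3 + 3 = α by ring]
  have hpt : ∀ v, √(∑ i, v i ^ 2) ^ (α - 3) * min γ (C * Real.exp (-(b * ∑ i, (v i + s i) ^ 2))) ≤
      D v := fun v => kernSc_minTrick_pt hα3 hb.le hC hγ0.le hr0 s v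
  -- integrability of the integrand
  have hmeas : AEStronglyMeasurable (fun v : Fin 3 → ℝ => √(∑ i, v i ^ 2) ^ (α - 3) *
      min γ (C * Real.exp (-(b * ∑ i, (v i + s i) ^ 2)))) := by
    refine ((kernSc_measurable_euclid_rpow (α - 3)).mul ?_).aestronglyMeasurable
    exact measurable_const.min (by fun_prop)
  have hint : Integrable (fun v : Fin 3 → ℝ => √(∑ i, v i ^ 2) ^ (α - 3) *
      min γ (C * Real.exp (-(b * ∑ i, (v i + s i) ^ 2)))) :=
    Integrable.mono' hDint hmeas (ae_of_all _ fun v => by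
      rw [Real.norm_eq_abs, abs_of_nonneg (mul_nonneg (Real.rpow_nonneg (Real.sqrt_nonneg _) _)
        (le_min hγ0.le (by positivity)))]
      exact hpt v)
  refine ⟨hint, ?_⟩
  -- the three small quantities
  have hb₁ : C * (3 * B * (r ^ α / α)) ≤ ε / 4 := by
    have h1 : r ^ α ≤ r ^ (1 : ℝ) := Real.rpow_le_rpow_of_exponent_ge hr0 hr1 hα1.le
    rw [Real.rpow_one] at h1
    have h2 : C * (3 * B * (r ^ α / α)) = M * r ^ α := by
      rw [hM]
      field_simp
    rw [h2]
    exact (mul_le_mul_of_nonneg_left h1 hM0).trans hδM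
  have hb₂ : r ^ (α - 3) * (C * Real.exp (-(b / 2 * Λ))) * J ≤ ε / 4 := by
    have h1 : r ^ (α - 3) * (C * Real.exp (-(b / 2 * Λ))) * J ≤ r ^ (α - 3) * (C * τ) * J :=
      mul_le_mul_of_nonneg_right (mul_le_mul_of_nonneg_left
        (mul_le_mul_of_nonneg_left hΛτ hC) (Real.rpow_nonneg hr0.le _)) hJ0
    have h2 : r ^ (α - 3) * (C * τ) * J = τ * (r ^ (α - 3) * C * J) := by ring
    have h3 : τ * (r ^ (α - 3) * C * J + 1) = ε / 4 := by
      rw [hτ]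
      field_simp
    have h4 : τ * (r ^ (α - 3) * C * J + 1) = τ * (r ^ (α - 3) * C * J) + τ := by ring
    linarith
  have hb₃ : r ^ (α - 3) * (γ * Real.exp (b / 2 * Λ)) * J ≤ ε / 4 := by
    have h2 : r ^ (α - 3) * (γ * Real.exp (b / 2 * Λ)) * J =
        γ * (r ^ (α - 3) * Real.exp (b / 2 * Λ) * J) := by ring
    have h3 : γ * (r ^ (α - 3) * Real.exp (b / 2 * Λ) * J + 1) = ε / 4 := by
      rw [hγ]
      field_simp
    have h4 : γ * (r ^ (α - 3) * Real.exp (b / 2 * Λ) * J + 1) =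
        γ * (r ^ (α - 3) * Real.exp (b / 2 * Λ) * J) + γ := by ring
    linarith
  calc ∫ v : Fin 3 → ℝ, √(∑ i, v i ^ 2) ^ (α - 3) * min γ (C * Real.exp (-(b * ∑ i, (v i + s i) ^ 2)))
      ≤ ∫ v, D v := integral_mono hint hDint hpt
    _ = C * (3 * B * (r ^ α / α)) +
        r ^ (α - 3) * (γ * Real.exp (b / 2 * Λ) + C * Real.exp (-(b / 2 * Λ))) * J := hDval
    _ = C * (3 * B * (r ^ α / α)) + r ^ (α - 3) * (γ * Real.exp (b / 2 * Λ)) * J +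
        r ^ (α - 3) * (C * Real.exp (-(b / 2 * Λ))) * J := by ring
    _ ≤ ε / 4 + ε / 4 + ε / 4 := add_le_add (add_le_add hb₁ hb₃) hb₂
    _ ≤ ε := by linarith

/-- **Registered helper sub-goal `stub_kernelScaling_auxMinTrick`** of stub `stub_kernelScaling`
(line `diffusive-branch-is-nonsaturation`, crux stmt-CriticalPhenomena-4799): the min trick.
[folklore] -/
theorem stub_kernelScaling_auxMinTrick :
    ∀ (α b C ε : ℝ), 1 < α → α < 2 → 0 < b → 0 ≤ C → 0 < ε → ∃ γ : ℝ, 0 < γ ∧ ∀ s : Fin 3 → ℝ,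
      MeasureTheory.Integrable (fun v : Fin 3 → ℝ => Real.sqrt (∑ i, v i ^ 2) ^ (α - 3) *
          min γ (C * Real.exp (-(b * ∑ i, (v i + s i) ^ 2)))) ∧
      ∫ v : Fin 3 → ℝ, Real.sqrt (∑ i, v i ^ 2) ^ (α - 3) *
          min γ (C * Real.exp (-(b * ∑ i, (v i + s i) ^ 2))) ≤ ε :=
  fun _α _b _C _ε hα1 hα2 hb hC hε => kernSc_minTrick hα1 hα2 hb hC hε

end Summit.CriticalPhenomena.Ising3DConformalLimit.Cruxes.DirectCorrelationStableTail.DiffusiveBranchIsNonsaturation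

end
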